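import Summits.KontsevichZagierPeriods.KontsevichZagierPeriods.Theses.WeightLine

/-!
# `WeightLine.BackwardVolterraRigidityOfPieces` — the split glue of `BackwardVolterraRigidity`

Pure proof file for route `WeightLine` closing the support item stmt-KontsevichZagierPeriods-17731
`BackwardVolterraRigidityOfPieces : UpperTruncationConstancy → TruncationExhaustion →
BackwardVolterraRigidity` BY NAME (crux-strategist r1 of stmt-KontsevichZagierPeriods-7177, BC2
redirect, 2026-08-17; authored by the planner, to be LANDED VERBATIM BY A PROVER as
`Summits/KontsevichZagierPeriods/KontsevichZagierPeriods/Theorems/WeightLineBackwardVolterraRigiditySplit.lean`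
— Theorems/ is prover-only). Rule (1) of the calculus only; axioms propext / Classical.choice / Quot.sound.

Notation: `R_j : KZ.IntegralRep (d_j + 1)` total representations, level `s` = last coordinate, `k_j ∈ ℤ`;
`D(t) = Σ k_j [T_j]` for presentations `T_j` of the upper truncations `R_j ∩ {s > t}`, `B(a,b]` the level
bands. Pieces (route items, rev 6): `UpperTruncationConstancy` (stmt-17729) — under the backward Volterra
relations `H(c)` of the crux, `D(t) − c ∈ relations` at every positive rational level off a finite
exceptional set `F`; `TruncationExhaustion` (stmt-17730) — if every band `(a, b]` with rational ends
`t₀ < a < b` outside a finite set is a relation, then `D(t₀)` is a relation.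

Proof of the glue: (i) constancy at two good levels `a < b` plus domain additivity for arbitrary
presentations ⇒ every band with good positive rational ends is a relation; (ii) a good level `a₀ > 0`
exists (F finite); exhaustion at `a₀` gives `D(a₀) ∈ rel`, constancy gives `D(a₀) − c ∈ rel`, hence
`c ∈ rel`; (iii) exhaustion at `t₀ = 0` gives `D(0) ∈ rel`.
References: M. Kontsevich, D. Zagier, *Periods* (2001), §1.2 rule (1).
-/

noncomputable section

open MeasureTheory Set
open Literature.NumberTheory.Transcendental Literature.NumberTheory.Transcendental.KZ

namespace Summit.KontsevichZagierPeriods.WeightLine.BackwardVolterraRigidityOfPieces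

/-! ## Helper lemmas (rule (1) bookkeeping, finite sets of levels) -/

/-- The open upper half-space `{z | t < z_last}` of `ℝ^{d+1}` at a rational level `t` is
`ℚ`-semialgebraic (`{C t < X_last}`). [cite: BochnakCosteRoy1998, Def. 2.1.4] -/
theorem isSemialgebraic_setOf_lt_last (d : ℕ) (t : ℚ) :
    Literature.ModelTheory.ExponentialFields.IsSemialgebraic ℚ
      {z : Fin (d + 1) → ℝ | (t : ℝ) < z (Fin.last d)} := by
  simpa [MvPolynomial.aeval_C, MvPolynomial.aeval_X] using
    Literature.ModelTheory.ExponentialFields.isSemialgebraic_setOf_eval_lt (k := ℚ) (R := ℝ)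
      (MvPolynomial.C t : MvPolynomial (Fin (d + 1)) ℚ) (MvPolynomial.X (Fin.last d))

/-- **Upper truncations are presentable**: `R ∩ {s > t}` is an integral representation with the
same integrand (`KZ.IntegralRep.restrict`). [cite: KontsevichZagier2001, §1.2] -/
theorem exists_upper_presentation {d : ℕ} (R : IntegralRep (d + 1)) (t : ℚ) :
    ∃ U : IntegralRep (d + 1),
      U.domain = R.domain ∩ {z | (t : ℝ) < z (Fin.last d)} ∧ U.integrand = R.integrand :=
  ⟨R.restrict _ (R.isSemialgebraic_domain.inter (isSemialgebraic_setOf_lt_last d t))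
      inter_subset_left, rfl, rfl⟩

/-- **Splitting an upper truncation at a higher level** (rule (1a)): for rational `a < b` and
presentations `U` of `R ∩ {s > a}`, `B` of `R ∩ {a < s ≤ b}`, `U'` of `R ∩ {s > b}`,
`[U] − [B] − [U']` is a relation. [cite: KontsevichZagier2001, §1.2 rule (1)] -/
theorem of_upper_sub_of_band_sub_of_upper_mem_relations {d : ℕ} (R U B U' : IntegralRep (d + 1))
    {a b : ℚ} (hab : a < b)
    (hU : U.domain = R.domain ∩ {z | (a : ℝ) < z (Fin.last d)} ∧ EqOn U.integrand R.integrand U.domain)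
    (hB : B.domain = R.domain ∩ {z | (a : ℝ) < z (Fin.last d) ∧ z (Fin.last d) ≤ (b : ℝ)} ∧
      EqOn B.integrand R.integrand B.domain)
    (hU' : U'.domain = R.domain ∩ {z | (b : ℝ) < z (Fin.last d)} ∧
      EqOn U'.integrand R.integrand U'.domain) :
    of U - of B - of U' ∈ relations := by
  have hab' : (a : ℝ) < b := by exact_mod_cast hab
  refine domainAddRel_subset_relations ⟨d + 1, U, B, U', ?_, ?_, ?_, ?_, rfl⟩
  · rw [hU.1, hB.1, hU'.1]
    ext z
    simp only [mem_inter_iff, mem_setOf_eq, mem_union]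
    constructor
    · rintro ⟨hz, hza⟩
      rcases le_or_gt (z (Fin.last d)) b with hzb | hzb
      · exact Or.inl ⟨hz, hza, hzb⟩
      · exact Or.inr ⟨hz, hzb⟩
    · rintro (⟨hz, hza, -⟩ | ⟨hz, hzb⟩)
      · exact ⟨hz, hza⟩
      · exact ⟨hz, hab'.trans hzb⟩
  · have : B.domain ∩ U'.domain = ∅ := by
      rw [hB.1, hU'.1]
      ext z
      simp only [mem_inter_iff, mem_setOf_eq, mem_empty_iff_false, iff_false]
      exact fun h => (not_lt.mpr h.1.2.2) h.2.2
    rw [this, measure_empty]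
  · intro z hz
    have hzU : z ∈ U.domain := by
      rw [hU.1]; rw [hB.1] at hz
      exact ⟨hz.1, hz.2.1⟩
    rw [hU.2 hzU, hB.2 hz]
  · intro z hz
    have hzU : z ∈ U.domain := by
      rw [hU.1]; rw [hU'.1] at hz
      exact ⟨hz.1, hab'.trans hz.2⟩
    rw [hU.2 hzU, hU'.2 hz]

/-- `ℤ`-combinations of relations are relations. [folklore] -/
theorem sum_zsmul_mem_relations {J : ℕ} (k : Fin J → ℤ) (x : Fin J → FormalRep)
    (hx : ∀ j, x j ∈ relations) : ∑ j, k j • x j ∈ relations :=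
  relations.sum_mem fun j _ => relations.zsmul_mem (hx j) (k j)

/-- **A level band between two constancy levels is a relation**: if every presentation of the upper
truncation at `a` and at `b` (`a < b` rational) is congruent to `c`, then every presentation of the
band `(a, b]` of the combination is a relation (rule (1a) for arbitrary presentations).
[cite: KontsevichZagier2001, §1.2 rule (1)] -/
theorem band_mem_relations_of_constancy {J : ℕ} {d : Fin J → ℕ} (k : Fin J → ℤ)
    (R : (j : Fin J) → IntegralRep (d j + 1)) (c : FormalRep) {a b : ℚ} (hab : a < b)
    (ha : ∀ (T : (j : Fin J) → IntegralRep (d j + 1)),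
      (∀ j, (T j).domain = (R j).domain ∩ {z | (a : ℝ) < z (Fin.last (d j))} ∧
        EqOn (T j).integrand (R j).integrand (T j).domain) → ∑ j, k j • of (T j) - c ∈ relations)
    (hb : ∀ (T : (j : Fin J) → IntegralRep (d j + 1)),
      (∀ j, (T j).domain = (R j).domain ∩ {z | (b : ℝ) < z (Fin.last (d j))} ∧
        EqOn (T j).integrand (R j).integrand (T j).domain) → ∑ j, k j • of (T j) - c ∈ relations)
    (B : (j : Fin J) → IntegralRep (d j + 1))
    (hB : ∀ j, (B j).domain = (R j).domain ∩ {z | (a : ℝ) < z (Fin.last (d j)) ∧ z (Fin.last (d j)) ≤ (b : ℝ)} ∧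
      EqOn (B j).integrand (R j).integrand (B j).domain) :
    ∑ j, k j • of (B j) ∈ relations := by
  choose U hUd hUi using fun j => exists_upper_presentation (R j) a
  choose U' hU'd hU'i using fun j => exists_upper_presentation (R j) b
  have hUp : ∀ j, (U j).domain = (R j).domain ∩ {z | (a : ℝ) < z (Fin.last (d j))} ∧
      EqOn (U j).integrand (R j).integrand (U j).domain :=
    fun j => ⟨hUd j, fun z _ => congrFun (hUi j) z⟩
  have hU'p : ∀ j, (U' j).domain = (R j).domain ∩ {z | (b : ℝ) < z (Fin.last (d j))} ∧
      EqOn (U' j).integrand (R j).integrand (U' j).domain :=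
    fun j => ⟨hU'd j, fun z _ => congrFun (hU'i j) z⟩
  have hsplit : ∑ j, k j • (of (U j) - of (B j) - of (U' j)) ∈ relations :=
    sum_zsmul_mem_relations k _ fun j =>
      of_upper_sub_of_band_sub_of_upper_mem_relations (R j) (U j) (B j) (U' j) hab
        (hUp j) (hB j) (hU'p j)
  have key : ∑ j, k j • of (B j) =
      (∑ j, k j • of (U j) - c) - (∑ j, k j • of (U' j) - c) -
        ∑ j, k j • (of (U j) - of (B j) - of (U' j)) := by
    simp only [smul_sub, Finset.sum_sub_distrib]
    abel
  rw [key]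
  exact relations.sub_mem (relations.sub_mem (ha U hUp) (hb U' hU'p)) hsplit

/-- A positive rational level avoiding a finite set of levels. [folklore] -/
theorem exists_pos_not_mem (F : Finset ℚ) : ∃ a : ℚ, 0 < a ∧ a ∉ F := by
  obtain ⟨M, hM⟩ := F.bddAbove
  refine ⟨max M 0 + 1, lt_of_le_of_lt (le_max_right M 0) (lt_add_one _), fun h => ?_⟩
  have h1 : max M 0 + 1 ≤ M := hM (Finset.mem_coe.mpr h)
  have h2 : M ≤ max M 0 := le_max_left M 0
  linarith



/-- **`BackwardVolterraRigidity` from its two pieces** (the split's glue, `UpperTruncationConstancy →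
TruncationExhaustion → BackwardVolterraRigidity`). (i) Constancy at two good levels `a < b` plus domain
additivity (`band_mem_relations_of_constancy`, arbitrary presentations) make every level band with good
positive rational ends a relation; (ii) a good level `a₀ > 0` exists because the exceptional set is
finite; exhaustion at `a₀` makes `D(a₀)` a relation and constancy makes `D(a₀) − c` one, so `c ≡ 0`;
(iii) exhaustion at `t₀ = 0` makes `D(0)` a relation. Uses rule (1) of the calculus only.
[cite: KontsevichZagier2001, §1.2 rule (1)] -/
theorem backwardVolterraRigidity_of_pieces
    (h₁ : Summit.KontsevichZagierPeriods.KontsevichZagierPeriods.Theses.WeightLine.UpperTruncationConstancy)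
    (h₂ : Summit.KontsevichZagierPeriods.KontsevichZagierPeriods.Theses.WeightLine.TruncationExhaustion) :
    Summit.KontsevichZagierPeriods.KontsevichZagierPeriods.Theses.WeightLine.BackwardVolterraRigidity := by
  intro J d k R c hH
  obtain ⟨F, hF⟩ := h₁ J d k R c hH
  -- (i) every level band between two good positive rational levels is a relation
  have hBand : ∀ a b : ℚ, 0 < (a : ℝ) → a < b → a ∉ F → b ∉ F →
      ∀ (B : (j : Fin J) → IntegralRep (d j + 1)),
      (∀ j, (B j).domain = (R j).domain ∩ {z | (a : ℝ) < z (Fin.last (d j)) ∧ z (Fin.last (d j)) ≤ (b : ℝ)} ∧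
        EqOn (B j).integrand (R j).integrand (B j).domain) →
      ∑ j, k j • of (B j) ∈ relations := by
    intro a b ha hab haF hbF B hB
    have hb : 0 < (b : ℝ) := ha.trans (by exact_mod_cast hab)
    exact band_mem_relations_of_constancy k R c hab (hF a ha haF) (hF b hb hbF) B hB
  -- (ii) the jump: at a good positive level `a₀`, exhaustion gives `D(a₀) ∈ rel` and constancy
  --      gives `D(a₀) − c ∈ rel`, hence `c ∈ rel`
  have hc : c ∈ relations := by
    obtain ⟨a₀, ha₀, ha₀F⟩ := exists_pos_not_mem F
    have ha₀' : 0 < ((a₀ : ℚ) : ℝ) := by exact_mod_cast ha₀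
    choose U hUd hUi using fun j => exists_upper_presentation (R j) a₀
    have hUp : ∀ j, (U j).domain = (R j).domain ∩ {z | ((a₀ : ℚ) : ℝ) < z (Fin.last (d j))} ∧
        EqOn (U j).integrand (R j).integrand (U j).domain :=
      fun j => ⟨hUd j, fun z _ => congrFun (hUi j) z⟩
    have hU0 : ∑ j, k j • of (U j) ∈ relations :=
      h₂ J d k R a₀ F (fun a b h0a hab haF hbF B hB =>
        hBand a b (by exact_mod_cast ha₀.trans h0a) hab haF hbF B hB) U hUp
    have hU1 : ∑ j, k j • of (U j) - c ∈ relations := hF a₀ ha₀' ha₀F U hUp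
    have key : c = ∑ j, k j • of (U j) - (∑ j, k j • of (U j) - c) := by abel
    rw [key]
    exact relations.sub_mem hU0 hU1
  refine ⟨hc, fun T₀ hT₀ => ?_⟩
  -- (iii) the truncation at level 0: exhaustion at `t₀ = 0` with the same exceptional set
  refine h₂ J d k R 0 F (fun a b h0a hab haF hbF B hB =>
    hBand a b (by exact_mod_cast h0a) hab haF hbF B hB) T₀ ?_
  intro j
  obtain ⟨h1, h2⟩ := hT₀ j
  exact ⟨by simpa using h1, h2⟩

/-- **The glue item by name**: `WeightLine.BackwardVolterraRigidityOfPieces`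
(stmt-KontsevichZagierPeriods-17731). [cite: KontsevichZagier2001, §1.2 rule (1)] -/
theorem backwardVolterraRigidityOfPieces_proof : Summit.KontsevichZagierPeriods.KontsevichZagierPeriods.Theses.WeightLine.BackwardVolterraRigidityOfPieces := by
  intro h₁ h₂
  exact backwardVolterraRigidity_of_pieces h₁ h₂

end Summit.KontsevichZagierPeriods.WeightLine.BackwardVolterraRigidityOfPieces

end
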